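import Literature.Geometry.Riemannian.GurskyViaclovskyC1Estimate
import Literature.Geometry.Riemannian.GurskyViaclovskyC2EstimateProofs
import Literature.Geometry.Lorentzian.CoordSigma2GradientEstimate
import HarnessLib

/-!
# Gursky–Viaclovsky 2003, Prop. 5 (the `C¹` estimate along the weighted `σ₂`-path), proved

Proof file for the named fact
`Literature.Geometry.Riemannian.gurskyViaclovsky_gradientEstimate_weighted_four`
(`GurskyViaclovskyC1Estimate.lean`; Gursky–Viaclovsky, J. Differential Geom. 63 (2003), §4,
Prop. 5: "Let `u_t` be a `C³` solution of (path) for some `δ ≤ t ≤ 1`, satisfying `u_t < δ̄`. Then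
`‖∇u_t‖_{L^∞} < C₁`, where `C₁` depends only upon `δ̄` and `g`"; for the `x`-dependent weight,
S. Chen, IMRN 2005:63, Thm. 1(a), Cor. 2). The published proof is the maximum principle for
`h = |∇u|²` in normal coordinates: the once differentiated equation, the Ricci identity
("Lemma 2 in [Jeff4]"), the cone algebra of Lemma 2 (Li–Li / Guan–Wang), and "since we are
assuming `u` is bounded above, the `|∇u|⁴` term dominates".

* The pointwise computation at a maximum point is
  `Literature/Geometry/Lorentzian/CoordSigma2GradientEstimate.lean` (in an orthonormal eigenframe
  of the Hessian; packaged with its constants on a compact coordinate set as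
  `MetricCoord.IsMetricOn.exists_gradSqAt_le_at_isLocalMax`), the cone algebra is
  `CoordSigma2GradientAlgebra.lean`, and Glaeser's inequality for the nonnegative weight `|W_g|²`
  is `Literature/Analysis/Calculus/GlaeserInequality.lean`.
* Here the path equation and the test function `|∇u|²_g` with its maximum are read in the chart
  at a point exactly as in `GurskyViaclovskyC2EstimateProofs.lean` (`IsPathSolution.chart_equation`,
  `IsPathSolution.mtrAt_chart_pos`, `gradSqAt_chart`: O'Neill 1983, Ch. 3, Prop. 3.59), giving the
  local claim `exists_nhds_gradSq_le`; compactness of `M` (a maximum point of `|∇u|²_g`, finitely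
  many charts) gives `gradSq_le_of_isPathSolution`, and the named fact
  `gurskyViaclovsky_gradientEstimate_weighted_four_holds` follows by unfolding.

Only the UPPER bound `u ≤ C₀` is used, as in the source (the lower bound of Prop. 4 comes after
the gradient bound in the continuity argument).

## References

* M. J. Gursky, J. A. Viaclovsky, J. Differential Geom. 63 (2003) 131–154, arXiv:math/0301350,
  §4, Prop. 5 and Lemma 2. [GurskyViaclovsky2003]
* S. Chen, Int. Math. Res. Not. 2005:63, 3937–3955, Thm. 1(a), Cor. 2. [Chen2005]
* B. O'Neill, *Semi-Riemannian geometry*, Academic Press 1983, Ch. 3, Prop. 3.59. [ONeill1983]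
-/

noncomputable section


open Bundle Set Function Module
open scoped Manifold ContDiff Topology

namespace Literature.Geometry.Riemannian.GurskyViaclovskyPath

open Lorentzian Lorentzian.PseudoRiemannianMetric

section LocalClaim

variable {M : Type*} [TopologicalSpace M] [ChartedSpace (EuclideanSpace ℝ (Fin 4)) M]
  [IsManifold (𝓡 4) ∞ M]
  (g : PseudoRiemannianMetric (𝓡 4) ∞ (EuclideanSpace ℝ (Fin 4)) (TangentSpace (𝓡 4) : M → Type _)) [g.HasLeviCivita]

set_option maxHeartbeats 4000000 in
/-- **The local gradient bound** (Gursky–Viaclovsky 2003, Prop. 5, read in the chart at `p`): for a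
Riemannian `g`, a smooth `q ≥ q₀ > 0` and levels `δ, C₀` there are a neighbourhood `U` of `p` and a
constant `C` such that for every `t ∈ [δ, 1]` and every path solution `(h, u)` with `u ≤ C₀`: at
every point of `U` where `|∇u|²_g` attains its maximum over `M`, `|∇u|²_g ≤ C`. The chart at `p`
carries the equation to the model space (`IsPathSolution.chart_equation`, `mtrAt_chart_pos`, the
chart dictionary) on a closed ball in the chart target, where
`MetricCoord.IsMetricOn.exists_gradSqAt_le_at_isLocalMax` applies.
[cite: GurskyViaclovsky2003, Prop. 5] [cite: Chen2005, Thm. 1(a), Cor. 2] -/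
theorem exists_nhds_gradSq_le (hg : g.IsRiemannian) {q : M → ℝ}
    (hq : ContMDiff (𝓡 4) 𝓘(ℝ) ∞ q) {q₀ : ℝ} (hq₀ : 0 < q₀) (hqq₀ : ∀ x, q₀ ≤ q x)
    (δ C₀ : ℝ) (p : M) :
    ∃ U ∈ 𝓝 p, ∃ C : ℝ, ∀ t : ℝ, δ ≤ t → t ≤ 1 →
      ∀ (h : PseudoRiemannianMetric (𝓡 4) ∞ (EuclideanSpace ℝ (Fin 4)) (TangentSpace (𝓡 4) : M → Type _)) [h.HasLeviCivita] (u : M → ℝ),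
        IsPathSolution g h u t q → (∀ x, u x ≤ C₀) →
        ∀ x ∈ U, IsMaxOn (fun z ↦ g.gradSq u z) univ x → g.gradSq u x ≤ C := by
  have hG := isMetricOn_chartRep g p
  have hE : finrank ℝ (EuclideanSpace ℝ (Fin 4)) = 4 := finrank_euclideanSpace_fin
  have hposV : ∀ y ∈ (chartTarget (𝓡 4) p : Set (EuclideanSpace ℝ (Fin 4))), ∀ v, v ≠ 0 → 0 < (chartRep (𝓡 4) (fun _ : ℝ ↦ g) p 0) y v v :=
    fun y hy v hv ↦ chartRep_pos g hg p hy v hv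
  -- a closed ball in the chart target around the image of `p`
  obtain ⟨r, hr, hrV⟩ := Metric.nhds_basis_closedBall.mem_iff.1
    ((isOpen_extChartAt_target (I := 𝓡 4) p).mem_nhds (mem_extChartAt_target (I := 𝓡 4) p))
  have hK : IsCompact (Metric.closedBall (extChartAt (𝓡 4) p p) r) := isCompact_closedBall _ _
  have hKV : Metric.closedBall (extChartAt (𝓡 4) p p) r ⊆ (chartTarget (𝓡 4) p : Set (EuclideanSpace ℝ (Fin 4))) := hrV
  -- the right-hand side data read in the chart
  have hwf : ContDiffOn ℝ ∞ (g.weylNormSq ∘ (extChartAt (𝓡 4) p).symm) (chartTarget (𝓡 4) p : Set (EuclideanSpace ℝ (Fin 4))) :=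
    contDiffOn_comp_extChartAt_symm (g.contMDiff_weylNormSq hg hE) p
  have hqf : ContDiffOn ℝ ∞ (q ∘ (extChartAt (𝓡 4) p).symm) (chartTarget (𝓡 4) p : Set (EuclideanSpace ℝ (Fin 4))) :=
    contDiffOn_comp_extChartAt_symm hq p
  have hwf0 : ∀ y ∈ (chartTarget (𝓡 4) p : Set (EuclideanSpace ℝ (Fin 4))), 0 ≤ (g.weylNormSq ∘ (extChartAt (𝓡 4) p).symm) y :=
    fun y _ ↦ g.weylNormSq_nonneg _
  have hqK : ∀ y ∈ Metric.closedBall (extChartAt (𝓡 4) p p) r, q₀ ≤ (q ∘ (extChartAt (𝓡 4) p).symm) y :=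
    fun y _ ↦ hqq₀ _
  obtain ⟨C, hC⟩ := hG.exists_gradSqAt_le_at_isLocalMax hE hposV hK hKV hwf hqf hwf0 hq₀ hqK C₀ δ
  -- the neighbourhood of `p`
  refine ⟨(extChartAt (𝓡 4) p).source ∩ extChartAt (𝓡 4) p ⁻¹' Metric.ball (extChartAt (𝓡 4) p p) r,
    Filter.inter_mem (extChartAt_source_mem_nhds (I := 𝓡 4) p)
      ((continuousAt_extChartAt (I := 𝓡 4) p).preimage_mem_nhds (Metric.ball_mem_nhds _ hr)), C, ?_⟩
  intro t ht1 ht2 h _ u hs hu0 x hx hmax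
  have hu : ContMDiff (𝓡 4) 𝓘(ℝ) ∞ u := hs.contMDiff
  have hxs : x ∈ (extChartAt (𝓡 4) p).source := hx.1
  have hyV : extChartAt (𝓡 4) p x ∈ (chartTarget (𝓡 4) p : Set (EuclideanSpace ℝ (Fin 4))) :=
    (extChartAt (𝓡 4) p).map_source hxs
  have hyK : extChartAt (𝓡 4) p x ∈ Metric.closedBall (extChartAt (𝓡 4) p p) r :=
    Metric.ball_subset_closedBall hx.2
  have hxc : x ∈ (chartAt (EuclideanSpace ℝ (Fin 4)) p).source := by rwa [← extChartAt_source (𝓡 4)]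
  have hxy : chartInv (𝓡 4) p ⟨extChartAt (𝓡 4) p x, hyV⟩ = x := chartInv_extChartAt p hxc
  have hfx : (u ∘ (extChartAt (𝓡 4) p).symm) (extChartAt (𝓡 4) p x) = u x := by
    simp only [Function.comp_apply, (extChartAt (𝓡 4) p).left_inv hxs]
  have hf : ContDiffOn ℝ ∞ (u ∘ (extChartAt (𝓡 4) p).symm) (chartTarget (𝓡 4) p : Set (EuclideanSpace ℝ (Fin 4))) :=
    contDiffOn_comp_extChartAt_symm hu p
  have heq : ∀ y ∈ (chartTarget (𝓡 4) p : Set (EuclideanSpace ℝ (Fin 4))),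
      1 / 2 * ((1 + 3 * ((1 - t) * (2 - t))) * MetricCoord.mtrAt (chartRep (𝓡 4) (fun _ : ℝ ↦ g) p 0) y
        ((fun z ↦ MetricCoord.hessAt (chartRep (𝓡 4) (fun _ : ℝ ↦ g) p 0) (u ∘ (extChartAt (𝓡 4) p).symm) z
        + ContinuousLinearMap.smulRightL ℝ (EuclideanSpace ℝ (Fin 4)) (EuclideanSpace ℝ (Fin 4) →L[ℝ] ℝ)
            (fderiv ℝ (u ∘ (extChartAt (𝓡 4) p).symm) z) (fderiv ℝ (u ∘ (extChartAt (𝓡 4) p).symm) z)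
        - (1 / 2 : ℝ) • (MetricCoord.gradSqAt (chartRep (𝓡 4) (fun _ : ℝ ↦ g) p 0) (u ∘ (extChartAt (𝓡 4) p).symm) z • (chartRep (𝓡 4) (fun _ : ℝ ↦ g) p 0) z)
        + (1 / 2 : ℝ) • (MetricCoord.ricAt (chartRep (𝓡 4) (fun _ : ℝ ↦ g) p 0) z - (MetricCoord.scalAt (chartRep (𝓡 4) (fun _ : ℝ ↦ g) p 0) z / 6) • (chartRep (𝓡 4) (fun _ : ℝ ↦ g) p 0) z)) y) ^ 2
        - MetricCoord.pairAt (chartRep (𝓡 4) (fun _ : ℝ ↦ g) p 0) y ((fun z ↦ MetricCoord.hessAt (chartRep (𝓡 4) (fun _ : ℝ ↦ g) p 0) (u ∘ (extChartAt (𝓡 4) p).symm) z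
        + ContinuousLinearMap.smulRightL ℝ (EuclideanSpace ℝ (Fin 4)) (EuclideanSpace ℝ (Fin 4) →L[ℝ] ℝ)
            (fderiv ℝ (u ∘ (extChartAt (𝓡 4) p).symm) z) (fderiv ℝ (u ∘ (extChartAt (𝓡 4) p).symm) z)
        - (1 / 2 : ℝ) • (MetricCoord.gradSqAt (chartRep (𝓡 4) (fun _ : ℝ ↦ g) p 0) (u ∘ (extChartAt (𝓡 4) p).symm) z • (chartRep (𝓡 4) (fun _ : ℝ ↦ g) p 0) z)
        + (1 / 2 : ℝ) • (MetricCoord.ricAt (chartRep (𝓡 4) (fun _ : ℝ ↦ g) p 0) z - (MetricCoord.scalAt (chartRep (𝓡 4) (fun _ : ℝ ↦ g) p 0) z / 6) • (chartRep (𝓡 4) (fun _ : ℝ ↦ g) p 0) z)) y) ((fun z ↦ MetricCoord.hessAt (chartRep (𝓡 4) (fun _ : ℝ ↦ g) p 0) (u ∘ (extChartAt (𝓡 4) p).symm) z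
        + ContinuousLinearMap.smulRightL ℝ (EuclideanSpace ℝ (Fin 4)) (EuclideanSpace ℝ (Fin 4) →L[ℝ] ℝ)
            (fderiv ℝ (u ∘ (extChartAt (𝓡 4) p).symm) z) (fderiv ℝ (u ∘ (extChartAt (𝓡 4) p).symm) z)
        - (1 / 2 : ℝ) • (MetricCoord.gradSqAt (chartRep (𝓡 4) (fun _ : ℝ ↦ g) p 0) (u ∘ (extChartAt (𝓡 4) p).symm) z • (chartRep (𝓡 4) (fun _ : ℝ ↦ g) p 0) z)
        + (1 / 2 : ℝ) • (MetricCoord.ricAt (chartRep (𝓡 4) (fun _ : ℝ ↦ g) p 0) z - (MetricCoord.scalAt (chartRep (𝓡 4) (fun _ : ℝ ↦ g) p 0) z / 6) • (chartRep (𝓡 4) (fun _ : ℝ ↦ g) p 0) z)) y))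
      = 1 / 16 * (g.weylNormSq ∘ (extChartAt (𝓡 4) p).symm) y
        + 1 / 4 * ((q ∘ (extChartAt (𝓡 4) p).symm) y * Real.exp (4 * (u ∘ (extChartAt (𝓡 4) p).symm) y)) :=
    fun y hy ↦ IsPathSolution.chart_equation g h hs p ⟨y, hy⟩
      (fun z ↦ MetricCoord.hessAt (chartRep (𝓡 4) (fun _ : ℝ ↦ g) p 0) (u ∘ (extChartAt (𝓡 4) p).symm) z
        + ContinuousLinearMap.smulRightL ℝ (EuclideanSpace ℝ (Fin 4)) (EuclideanSpace ℝ (Fin 4) →L[ℝ] ℝ)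
            (fderiv ℝ (u ∘ (extChartAt (𝓡 4) p).symm) z) (fderiv ℝ (u ∘ (extChartAt (𝓡 4) p).symm) z)
        - (1 / 2 : ℝ) • (MetricCoord.gradSqAt (chartRep (𝓡 4) (fun _ : ℝ ↦ g) p 0) (u ∘ (extChartAt (𝓡 4) p).symm) z • (chartRep (𝓡 4) (fun _ : ℝ ↦ g) p 0) z)
        + (1 / 2 : ℝ) • (MetricCoord.ricAt (chartRep (𝓡 4) (fun _ : ℝ ↦ g) p 0) z - (MetricCoord.scalAt (chartRep (𝓡 4) (fun _ : ℝ ↦ g) p 0) z / 6) • (chartRep (𝓡 4) (fun _ : ℝ ↦ g) p 0) z)) rfl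
  have hw : ∀ y ∈ (chartTarget (𝓡 4) p : Set (EuclideanSpace ℝ (Fin 4))),
      0 < MetricCoord.mtrAt (chartRep (𝓡 4) (fun _ : ℝ ↦ g) p 0) y ((fun z ↦ MetricCoord.hessAt (chartRep (𝓡 4) (fun _ : ℝ ↦ g) p 0) (u ∘ (extChartAt (𝓡 4) p).symm) z
        + ContinuousLinearMap.smulRightL ℝ (EuclideanSpace ℝ (Fin 4)) (EuclideanSpace ℝ (Fin 4) →L[ℝ] ℝ)
            (fderiv ℝ (u ∘ (extChartAt (𝓡 4) p).symm) z) (fderiv ℝ (u ∘ (extChartAt (𝓡 4) p).symm) z)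
        - (1 / 2 : ℝ) • (MetricCoord.gradSqAt (chartRep (𝓡 4) (fun _ : ℝ ↦ g) p 0) (u ∘ (extChartAt (𝓡 4) p).symm) z • (chartRep (𝓡 4) (fun _ : ℝ ↦ g) p 0) z)
        + (1 / 2 : ℝ) • (MetricCoord.ricAt (chartRep (𝓡 4) (fun _ : ℝ ↦ g) p 0) z - (MetricCoord.scalAt (chartRep (𝓡 4) (fun _ : ℝ ↦ g) p 0) z / 6) • (chartRep (𝓡 4) (fun _ : ℝ ↦ g) p 0) z)) y) :=
    fun y hy ↦ IsPathSolution.mtrAt_chart_pos g h hs p ⟨y, hy⟩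
      (fun z ↦ MetricCoord.hessAt (chartRep (𝓡 4) (fun _ : ℝ ↦ g) p 0) (u ∘ (extChartAt (𝓡 4) p).symm) z
        + ContinuousLinearMap.smulRightL ℝ (EuclideanSpace ℝ (Fin 4)) (EuclideanSpace ℝ (Fin 4) →L[ℝ] ℝ)
            (fderiv ℝ (u ∘ (extChartAt (𝓡 4) p).symm) z) (fderiv ℝ (u ∘ (extChartAt (𝓡 4) p).symm) z)
        - (1 / 2 : ℝ) • (MetricCoord.gradSqAt (chartRep (𝓡 4) (fun _ : ℝ ↦ g) p 0) (u ∘ (extChartAt (𝓡 4) p).symm) z • (chartRep (𝓡 4) (fun _ : ℝ ↦ g) p 0) z)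
        + (1 / 2 : ℝ) • (MetricCoord.ricAt (chartRep (𝓡 4) (fun _ : ℝ ↦ g) p 0) z - (MetricCoord.scalAt (chartRep (𝓡 4) (fun _ : ℝ ↦ g) p 0) z / 6) • (chartRep (𝓡 4) (fun _ : ℝ ↦ g) p 0) z)) rfl
  have hf0 : (u ∘ (extChartAt (𝓡 4) p).symm) (extChartAt (𝓡 4) p x) ≤ C₀ := by rw [hfx]; exact hu0 x
  have hlocmax : IsLocalMax (MetricCoord.gradSqAt (chartRep (𝓡 4) (fun _ : ℝ ↦ g) p 0) (u ∘ (extChartAt (𝓡 4) p).symm))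
      (extChartAt (𝓡 4) p x) := by
    refine Filter.eventually_of_mem ((isOpen_extChartAt_target (I := 𝓡 4) p).mem_nhds hyV) fun z hz ↦ ?_
    have h2 := gradSqAt_chart g hu p ⟨z, hz⟩
    have h4 := gradSqAt_chart g hu p ⟨extChartAt (𝓡 4) p x, hyV⟩
    rw [hxy] at h4
    simp only [h2, h4]
    exact hmax (mem_univ _)
  have hfin := hC t ht1 ht2 (u ∘ (extChartAt (𝓡 4) p).symm) (fun z ↦ MetricCoord.hessAt (chartRep (𝓡 4) (fun _ : ℝ ↦ g) p 0) (u ∘ (extChartAt (𝓡 4) p).symm) z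
        + ContinuousLinearMap.smulRightL ℝ (EuclideanSpace ℝ (Fin 4)) (EuclideanSpace ℝ (Fin 4) →L[ℝ] ℝ)
            (fderiv ℝ (u ∘ (extChartAt (𝓡 4) p).symm) z) (fderiv ℝ (u ∘ (extChartAt (𝓡 4) p).symm) z)
        - (1 / 2 : ℝ) • (MetricCoord.gradSqAt (chartRep (𝓡 4) (fun _ : ℝ ↦ g) p 0) (u ∘ (extChartAt (𝓡 4) p).symm) z • (chartRep (𝓡 4) (fun _ : ℝ ↦ g) p 0) z)
        + (1 / 2 : ℝ) • (MetricCoord.ricAt (chartRep (𝓡 4) (fun _ : ℝ ↦ g) p 0) z - (MetricCoord.scalAt (chartRep (𝓡 4) (fun _ : ℝ ↦ g) p 0) z / 6) • (chartRep (𝓡 4) (fun _ : ℝ ↦ g) p 0) z)) hf rfl heq hw (extChartAt (𝓡 4) p x) hyK hf0 hlocmax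
  have h3 := gradSqAt_chart g hu p ⟨extChartAt (𝓡 4) p x, hyV⟩
  rw [hxy] at h3
  rwa [h3] at hfin

end LocalClaim

section Global

variable {M : Type*} [TopologicalSpace M] [CompactSpace M] [ChartedSpace (EuclideanSpace ℝ (Fin 4)) M]
  [IsManifold (𝓡 4) ∞ M]
  (g : PseudoRiemannianMetric (𝓡 4) ∞ (EuclideanSpace ℝ (Fin 4)) (TangentSpace (𝓡 4) : M → Type _)) [g.HasLeviCivita]

/-- **The gradient bound** (Gursky–Viaclovsky 2003, Prop. 5, with the constant of Chen 2005,
Cor. 2): on a compact `4`-manifold, along the weighted `σ₂`-path with the upper bound `u ≤ C₀`,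
`|∇u|²_g ≤ C₁` with `C₁` independent of `t ∈ [δ, 1]` (the maximum principle for `|∇u|²`, at a
maximum point read in one of finitely many charts covering `M`).
[cite: GurskyViaclovsky2003, Prop. 5] [cite: Chen2005, Thm. 1(a), Cor. 2] -/
theorem gradSq_le_of_isPathSolution (hg : g.IsRiemannian) (q : M → ℝ) (δ C₀ : ℝ)
    (hq : ContMDiff (𝓡 4) 𝓘(ℝ) ∞ q) (hq0 : ∀ x, 0 < q x) :
    ∃ C₁ : ℝ, ∀ t : ℝ, δ ≤ t → t ≤ 1 →
      ∀ (h : PseudoRiemannianMetric (𝓡 4) ∞ (EuclideanSpace ℝ (Fin 4)) (TangentSpace (𝓡 4) : M → Type _)) [h.HasLeviCivita] (u : M → ℝ),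
        IsPathSolution g h u t q → (∀ x, u x ≤ C₀) → ∀ x, g.gradSq u x ≤ C₁ := by
  classical
  rcases isEmpty_or_nonempty M with hM | hM
  · exact ⟨0, fun t _ _ h _ u _ _ x ↦ (IsEmpty.false x).elim⟩
  · -- `q` attains a positive minimum
    obtain ⟨x₁, -, hx₁⟩ := isCompact_univ.exists_isMinOn univ_nonempty hq.continuous.continuousOn
    have hqq₀ : ∀ x, q x₁ ≤ q x := fun x ↦ hx₁ (mem_univ x)
    -- local bounds and a finite subcover
    choose U hU C hC using fun p ↦ exists_nhds_gradSq_le g hg hq (hq0 x₁) hqq₀ δ C₀ p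
    obtain ⟨s, -, hs⟩ := isCompact_univ.elim_nhds_subcover U fun p _ ↦ hU p
    refine ⟨∑ p ∈ s, |C p|, ?_⟩
    intro t ht1 ht2 h _ u hsol hu0 x
    have hu : ContMDiff (𝓡 4) 𝓘(ℝ) ∞ u := hsol.contMDiff
    -- a maximum point of `|∇u|²`
    have hLc : Continuous fun z ↦ g.gradSq u z :=
      continuous_innerDual_mvfderiv g (hu.of_le (by norm_cast)) (hu.of_le (by norm_cast))
    obtain ⟨x₀, -, hx₀⟩ := isCompact_univ.exists_isMaxOn univ_nonempty hLc.continuousOn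
    obtain ⟨p, hp, hxp⟩ := Set.mem_iUnion₂.1 (hs (mem_univ x₀))
    have h1 : g.gradSq u x₀ ≤ C p := hC p t ht1 ht2 h u hsol hu0 x₀ hxp hx₀
    have h2 : C p ≤ ∑ p ∈ s, |C p| :=
      (le_abs_self _).trans (Finset.single_le_sum (f := fun p ↦ |C p|) (fun _ _ ↦ abs_nonneg _) hp)
    have h3 : g.gradSq u x ≤ g.gradSq u x₀ := hx₀ (mem_univ x)
    linarith

end Global

/-! ## Assembly: the named fact -/

/-- **Gursky–Viaclovsky 2003, Prop. 5 (`C¹` estimate along the weighted `σ₂`-path), proved**: the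
maximum principle for `|∇u|²_g` (`gradSq_le_of_isPathSolution`; pointwise computation in charts,
`Literature/Geometry/Lorentzian/CoordSigma2GradientEstimate.lean`), using only the upper bound on
`u`. [cite: GurskyViaclovsky2003, Prop. 5] [cite: Chen2005, Thm. 1(a), Cor. 2] -/
theorem _root_.Literature.Geometry.Riemannian.gurskyViaclovsky_gradientEstimate_weighted_four_holds :
    gurskyViaclovsky_gradientEstimate_weighted_four := by
  intro M _ _ _ _ _ _ g _ hg q δ C₀ hq hq0 _
  exact gradSq_le_of_isPathSolution (M := M) g hg q δ C₀ hq hq0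

end Literature.Geometry.Riemannian.GurskyViaclovskyPath

end
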